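import Mathlib
import Summits.ValiantsHypothesis.ValiantsHypothesis.Theorems.KPlusLogSqLawWeakLiftingTowerGraftClusterDiscs
import Summits.ValiantsHypothesis.ValiantsHypothesis.Theorems.KPlusLogSqLawWeakLiftingTowerGraftRankOneGraft
import Summits.ValiantsHypothesis.ValiantsHypothesis.Theorems.LacunarySymmetroidMatrixDescartesDegreeCeiling

/-!
# Tower graft line — T1 FOR THE CORNER GRAFT IN PENCIL CURRENCY: crossings charged to cluster discs of `det G · det G₀₀`

Mechanism file for the line `Cruxes/WeakLifting/Lines/tower_graft.lean` (crux `WeakLifting` = stmt-ValiantsHypothesis-19561,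
memo `tower_graft-S5.md` §3 T1/T2); the pencil-currency corollary of `…TowerGraftClusterDiscs.lean`
(`card_posRoots_add_X_pow_mul_le_of_discs`, T1 in general).  NO stub is claimed.

THE COROLLARY (`card_posRoots_cornerGraft_le_of_discs`).  Corner graft of the line, `det (G + X^D•E₀₀) = det G + X^D·det G₀₀`
(`det_add_smul_single_zero`), `G = Σₗ X^{dₗ} Sₗ` of size `m+1` with symmetric letters, exponents `dₗ ≤ dmax`, class budgets
`PosRootLawOn (m+1) K B d` and `PosRootLawOn m K B₀ d`… — no: only the budget at size `m` for the minor is needed, through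
`Z₊(det G₀₀) ≤ B₀`.  Steepness `4(2m+1)·dmax ≤ s·D` (`0 < s ≤ 1`, `D > 0`).  For ANY finite disc system with CLEARANCE (every complex root
`z` of `det G·det G₀₀` keeps distance `≥ 4ρ‖z‖` from every circle, `ρ = (deg det G + deg det G₀₀)/D`, circles avoiding `0`) and COVERAGE
(every `t > 0` within `4ρ‖z‖` of an in-sector root lies in a disc):
`#{t > 0 : det(G + X^D E₀₀)(t) = 0} ≤ 2·Σᵢ #{distinct roots of det G·det G₀₀ in disc i} + 2·B₀ + 1`.
So on a steep tower the corner graft's count is TWICE the number of distinct near-axis roots of the two class determinants in the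
cluster discs, plus twice the minor's budget, plus one — the exact price tag T2 must meet (real in-disc roots are ≤ B + B₀ by the class
budgets; the NON-REAL near-axis roots are the open object).
HONEST FRAMING: bookkeeping over `…ClusterDiscs`; nothing on S4/S4b/S5, TowerB, `WeakLifting`, B, 18050 or `VP ≠ VNP`.  Def-free.
Seat: prover val-sym-lift-p1 g20, `--supports stmt-ValiantsHypothesis-19561`.
-/

-- `Summit.ValiantsHypothesis.ValiantsHypothesis.…` repeats a component by the D-0017 layout
-- (single-conjunct summit), which the `dupNamespace` linter flags; the name is mandated.
set_option linter.dupNamespace false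

namespace Summit.ValiantsHypothesis.ValiantsHypothesis.Theorems.KPlusLogSqLaw.TowerGraft

open Polynomial Complex
open scoped BigOperators Polynomial Real
open Summit.ValiantsHypothesis.ValiantsHypothesis.Theorems.LacunarySymmetroidMatrixDescartes (PosRootLawOn)

section Corner

variable {m : ℕ}

/-- **CORNER GRAFT, T1 IN GENERAL (pencil currency).**  See the module docstring. [this work] -/
theorem card_posRoots_cornerGraft_le_of_discs {K B₀ : ℕ} (d : Fin K → ℕ) (dmax : ℕ) {D : ℕ} (hD : 0 < D) (hd : ∀ l, d l ≤ dmax)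
    (hK : 0 < K) (hB₀ : PosRootLawOn (m + 1) K B₀ d)
    (S : Fin K → Matrix (Fin (m + 1)) (Fin (m + 1)) ℝ) (hS : ∀ l, (S l).IsSymm) {s : ℝ} (hs : 0 < s) (hs1 : s ≤ 1)
    (hsteep : 4 * (((m : ℝ) + 1 + m) * dmax) ≤ s * D)
    (hG : (∑ l, ((X : ℝ[X]) ^ d l) • (S l).map C).det ≠ 0)
    (hG₀ : (∑ l, ((X : ℝ[X]) ^ d l) • ((S l).submatrix Fin.succ Fin.succ).map C).det ≠ 0)
    {ι : Type*} (I : Finset ι) (ctr : ι → ℂ) (rad : ι → ℝ) (hrad : ∀ i ∈ I, 0 < rad i)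
    (h0 : ∀ i ∈ I, ∀ τ ∈ Metric.sphere (ctr i) (rad i), τ ≠ 0)
    (hclear : ∀ i ∈ I, ∀ τ ∈ Metric.sphere (ctr i) (rad i),
      ∀ z ∈ ((∑ l, ((X : ℝ[X]) ^ d l) • (S l).map C).det.map Complex.ofRealHom).roots +
        ((∑ l, ((X : ℝ[X]) ^ d l) • ((S l).submatrix Fin.succ Fin.succ).map C).det.map Complex.ofRealHom).roots,
        4 * ((((∑ l, ((X : ℝ[X]) ^ d l) • (S l).map C).det.natDegree : ℝ) +
          (∑ l, ((X : ℝ[X]) ^ d l) • ((S l).submatrix Fin.succ Fin.succ).map C).det.natDegree) / D) * ‖z‖ ≤ ‖τ - z‖)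
    (hcover : ∀ z ∈ ((∑ l, ((X : ℝ[X]) ^ d l) • (S l).map C).det.map Complex.ofRealHom).roots +
        ((∑ l, ((X : ℝ[X]) ^ d l) • ((S l).submatrix Fin.succ Fin.succ).map C).det.map Complex.ofRealHom).roots,
      ¬ (s * ‖z‖ ≤ |z.im| ∨ z.re ≤ 0) → ∀ t : ℝ, 0 < t →
        ‖(t : ℂ) - z‖ ≤ 4 * ((((∑ l, ((X : ℝ[X]) ^ d l) • (S l).map C).det.natDegree : ℝ) +
          (∑ l, ((X : ℝ[X]) ^ d l) • ((S l).submatrix Fin.succ Fin.succ).map C).det.natDegree) / D) * ‖z‖ →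
        ∃ i ∈ I, dist (t : ℂ) (ctr i) < rad i) :
    (((∑ l, ((X : ℝ[X]) ^ d l) • (S l).map C) +
          (X : ℝ[X]) ^ D • Matrix.single (0 : Fin (m + 1)) (0 : Fin (m + 1)) (1 : ℝ[X])).det.roots.toFinset.filter
        (fun t => 0 < t)).card ≤
      2 * ∑ i ∈ I, ((((∑ l, ((X : ℝ[X]) ^ d l) • (S l).map C).det *
          (∑ l, ((X : ℝ[X]) ^ d l) • ((S l).submatrix Fin.succ Fin.succ).map C).det).map Complex.ofRealHom).roots.filter
          fun z => dist z (ctr i) < rad i).toFinset.card + 2 * B₀ + 1 := by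
  set G := ∑ l, ((X : ℝ[X]) ^ d l) • (S l).map C with hGdef
  set A := G.det with hAdef
  set E := (∑ l, ((X : ℝ[X]) ^ d l) • ((S l).submatrix Fin.succ Fin.succ).map C).det with hEdef
  have hGsub : G.submatrix Fin.succ Fin.succ =
      ∑ l, ((X : ℝ[X]) ^ d l) • ((S l).submatrix Fin.succ Fin.succ).map C := by
    refine Matrix.ext fun i j => ?_
    simp [hGdef, Matrix.submatrix_apply, Matrix.sum_apply, Matrix.smul_apply, Matrix.map_apply]
  rw [det_add_smul_single_zero, hGsub, ← hAdef, ← hEdef]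
  have hdegA : (A.natDegree : ℝ) ≤ (m + 1) * dmax := by
    exact_mod_cast LacunarySymmetroidMatrixDescartes.DegreeCeiling.natDegree_det_pencil_le d S dmax hd
  have hdegE : (E.natDegree : ℝ) ≤ m * dmax := by
    exact_mod_cast LacunarySymmetroidMatrixDescartes.DegreeCeiling.natDegree_det_pencil_le d
      (fun l => (S l).submatrix Fin.succ Fin.succ) dmax hd
  have hdeg : 4 * ((A.natDegree : ℝ) + E.natDegree) ≤ s * D := by
    have : ((m : ℝ) + 1 + m) * dmax = (m + 1) * dmax + m * dmax := by ring
    linarith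
  have h1 := card_posRoots_add_X_pow_mul_le_of_discs hs hs1 A E hD hG hG₀ hdeg I ctr rad hrad h0 hclear hcover
  have h2 : (E.roots.toFinset.filter (fun t => 0 < t)).card ≤ B₀ :=
    posRootLawOn_of_succ hK hB₀ (fun l => (S l).submatrix Fin.succ Fin.succ) (fun l => (hS l).submatrix _)
  omega

end Corner

end Summit.ValiantsHypothesis.ValiantsHypothesis.Theorems.KPlusLogSqLaw.TowerGraft
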